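import Summits.HubbardSuperconductivity.HubbardSuperconductivity.Theses.BalabanIR
import Literature.Computability.AlgebraicComplexity.SubspaceProjection
import Literature.MathematicalPhysics.QuantumLattice.LTQOProofs
import Literature.MathematicalPhysics.QuantumLattice.HubbardRingPerronFrobeniusProofs

/-!
# Route BalabanIR — target `BirGroundStateAverageLRO`: skeleton and trace-average glue

Helper lemmas for the target item `stmt-HubbardSuperconductivity-2079` of route BalabanIR
(`Summit.HubbardSuperconductivity.HubbardSuperconductivity.Theses.BalabanIR.BirGroundStateAverageLRO`,
ground-state-AVERAGE `d_{x²-y²}` pair-field long-range order on an open window of couplings).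

* `birGroundStateAverageLRO_of_engine` — the route's composition: the target follows from the engine
  `BirComplexStableXY` (crux 2) and the reduction `BirGappedPhaseReduction := engine → target`
  (crux 4). This is the skeleton closed modulo the two cruxes.
* Trace-average glue for the basis-free formulation `c · Re tr P ≤ Re tr (P A)`,
  `P = projMatrix (K.map toEuclidean)`: `tr P = dim K` (`trace_projMatrix_map`), the state-wise
  bound implies the trace bound (`mul_re_trace_projMatrix_map_le`), and conversely the trace bound
  yields a unit vector of `K` carrying the bound (`exists_unit_le_re_of_trace_projMatrix_map`).
* Non-vacuity of the target: the sector ground eigenspace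
  `szSector (2n) 0 ⊓ eigenspace (toLin' (hubbardTorus 2 L t U)) (minEnergyOn …)` is `≠ ⊥` for
  `n ≤ L²` (`hubbardTorus_groundEigenspace_ne_bot`), so `Re tr P ≥ 1` in the target and the
  inequality is not the trivial `0 ≤ 0`.
* `birGroundStateAverageLRO_of_forall_groundState` — the EVERY-ground-state form (each normalised
  sector ground state has `⟨Δ_d† Δ_d⟩ ≥ c L⁴`) implies the target (average form); conversely
  `exists_groundState_le_of_trace_bound` extracts from the target's bound at `(U, L)` one
  normalised sector ground state with `⟨Δ_d† Δ_d⟩ ≥ c L⁴` (first step of crux 5, average → every).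

All linear algebra is folklore (orthonormal frames `P = B Bᴴ`,
`Literature.Computability.AlgebraicComplexity.exists_orthonormalFrame`).
-/

namespace Summit.HubbardSuperconductivity.HubbardSuperconductivity.Theorems

open Matrix Literature.MathematicalPhysics.QuantumLattice
open Literature.Computability.AlgebraicComplexity
open Summit.HubbardSuperconductivity.HubbardSuperconductivity.Theses.BalabanIR

/-- **Skeleton of route BalabanIR at the target.** The target `BirGroundStateAverageLRO` follows
from the engine `BirComplexStableXY` (crux 2, item 2080) and the reduction
`BirGappedPhaseReduction := BirComplexStableXY → BirGroundStateAverageLRO` (crux 4, item 2082)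
by modus ponens. -/
theorem birGroundStateAverageLRO_of_engine (hEngine : BirComplexStableXY)
    (hRed : BirGappedPhaseReduction) : BirGroundStateAverageLRO :=
  hRed hEngine

section TraceAverage

variable {n : Type*} [Fintype n] [DecidableEq n]

/-- **`tr P_K = dim K`.** The projection matrix onto (the transport to `EuclideanSpace` of) a
subspace `K ≤ ℂⁿ` has trace `finrank K` (it is Hermitian, fixes `K` and maps into `K`, hence is
the frame projection `B Bᴴ`; folklore). -/
theorem trace_projMatrix_map (K : Submodule ℂ (n → ℂ)) :
    (projMatrix (K.map
      ((WithLp.linearEquiv 2 ℂ (n → ℂ)).symm : (n → ℂ) →ₗ[ℂ] EuclideanSpace ℂ n))).trace =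
      (Module.finrank ℂ K : ℂ) :=
  trace_eq_finrank_of_proj (projMatrix_isHermitian _)
    (fun _ hw => projMatrix_map_mulVec_of_mem K hw) (projMatrix_map_mulVec_mem K)

/-- **State-wise bound ⇒ trace bound.** If every unit vector `ψ ∈ K` has `c ≤ Re ⟨ψ, A ψ⟩`, then
`c · Re tr P_K ≤ Re tr (P_K A)` (write `P_K = B Bᴴ` for an orthonormal frame `B` of `K`; then
`tr (P_K A) = Σ_j ⟨b_j, A b_j⟩` over the columns `b_j ∈ K`; folklore). -/
theorem mul_re_trace_projMatrix_map_le (K : Submodule ℂ (n → ℂ)) (A : Matrix n n ℂ) (c : ℝ)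
    (h : ∀ ψ ∈ K, star ψ ⬝ᵥ ψ = 1 → c ≤ (star ψ ⬝ᵥ A *ᵥ ψ).re) :
    c * (projMatrix (K.map
        ((WithLp.linearEquiv 2 ℂ (n → ℂ)).symm : (n → ℂ) →ₗ[ℂ] EuclideanSpace ℂ n))).trace.re ≤
      (projMatrix (K.map
        ((WithLp.linearEquiv 2 ℂ (n → ℂ)).symm : (n → ℂ) →ₗ[ℂ] EuclideanSpace ℂ n)) * A).trace.re := by
  obtain ⟨k, B, hk, hBB, hcol, hfix⟩ := exists_orthonormalFrame K
  have hP : projMatrix (K.map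
      ((WithLp.linearEquiv 2 ℂ (n → ℂ)).symm : (n → ℂ) →ₗ[ℂ] EuclideanSpace ℂ n)) = B * Bᴴ :=
    proj_unique (projMatrix_isHermitian _) (Matrix.isHermitian_mul_conjTranspose_self B)
      (fun _ hw => projMatrix_map_mulVec_of_mem K hw) (projMatrix_map_mulVec_mem K) hfix
      (frame_proj_mulVec_mem hcol)
  -- diagonal entries of `Bᴴ (A B)` are the expectations in the columns
  have hdiag : ∀ j : Fin k,
      (Bᴴ * (A * B)) j j = star (fun x => B x j) ⬝ᵥ A *ᵥ (fun x => B x j) := by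
    intro j
    simp only [Matrix.mul_apply, Matrix.conjTranspose_apply, dotProduct, Matrix.mulVec,
      Pi.star_apply]
  have hunit : ∀ j : Fin k, star (fun x => B x j) ⬝ᵥ (fun x => B x j) = 1 := by
    intro j
    have := congrFun (congrFun hBB j) j
    simpa [Matrix.mul_apply, Matrix.conjTranspose_apply, dotProduct, Matrix.one_apply] using this
  rw [hP, frame_proj_trace hBB, Matrix.mul_assoc, Matrix.trace_mul_comm, Matrix.mul_assoc,
    Matrix.trace]
  simp only [Matrix.diag_apply, Complex.re_sum, Complex.natCast_re]
  calc c * (k : ℝ) = ∑ _j : Fin k, c := by simp [mul_comm]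
    _ ≤ ∑ j : Fin k, ((Bᴴ * (A * B)) j j).re :=
        Finset.sum_le_sum fun j _ => by rw [hdiag]; exact h _ (hcol j) (hunit j)

/-- **Trace bound ⇒ a good unit vector.** If `K ≠ ⊥` and `c · Re tr P_K ≤ Re tr (P_K A)`, some
unit vector `ψ ∈ K` has `c ≤ Re ⟨ψ, A ψ⟩` (pigeonhole over an orthonormal frame; folklore). -/
theorem exists_unit_le_re_of_trace_projMatrix_map (K : Submodule ℂ (n → ℂ)) (hK : K ≠ ⊥)
    (A : Matrix n n ℂ) (c : ℝ)
    (h : c * (projMatrix (K.map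
        ((WithLp.linearEquiv 2 ℂ (n → ℂ)).symm : (n → ℂ) →ₗ[ℂ] EuclideanSpace ℂ n))).trace.re ≤
      (projMatrix (K.map
        ((WithLp.linearEquiv 2 ℂ (n → ℂ)).symm : (n → ℂ) →ₗ[ℂ] EuclideanSpace ℂ n)) * A).trace.re) :
    ∃ ψ ∈ K, star ψ ⬝ᵥ ψ = 1 ∧ c ≤ (star ψ ⬝ᵥ A *ᵥ ψ).re := by
  obtain ⟨k, B, hk, hBB, hcol, hfix⟩ := exists_orthonormalFrame K
  have hP : projMatrix (K.map
      ((WithLp.linearEquiv 2 ℂ (n → ℂ)).symm : (n → ℂ) →ₗ[ℂ] EuclideanSpace ℂ n)) = B * Bᴴ :=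
    proj_unique (projMatrix_isHermitian _) (Matrix.isHermitian_mul_conjTranspose_self B)
      (fun _ hw => projMatrix_map_mulVec_of_mem K hw) (projMatrix_map_mulVec_mem K) hfix
      (frame_proj_mulVec_mem hcol)
  have hdiag : ∀ j : Fin k,
      (Bᴴ * (A * B)) j j = star (fun x => B x j) ⬝ᵥ A *ᵥ (fun x => B x j) := by
    intro j
    simp only [Matrix.mul_apply, Matrix.conjTranspose_apply, dotProduct, Matrix.mulVec,
      Pi.star_apply]
  have hunit : ∀ j : Fin k, star (fun x => B x j) ⬝ᵥ (fun x => B x j) = 1 := by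
    intro j
    have := congrFun (congrFun hBB j) j
    simpa [Matrix.mul_apply, Matrix.conjTranspose_apply, dotProduct, Matrix.one_apply] using this
  have hkpos : 0 < k := by
    rw [hk]
    exact Submodule.one_le_finrank_iff.mpr hK
  rw [hP, frame_proj_trace hBB, Matrix.mul_assoc, Matrix.trace_mul_comm, Matrix.mul_assoc,
    Matrix.trace] at h
  simp only [Matrix.diag_apply, Complex.re_sum, Complex.natCast_re] at h
  have hsum : ∑ _j : Fin k, c ≤ ∑ j : Fin k, ((Bᴴ * (A * B)) j j).re := by
    simpa [mul_comm] using h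
  haveI : Nonempty (Fin k) := ⟨⟨0, hkpos⟩⟩
  obtain ⟨j, -, hj⟩ := Finset.exists_le_of_sum_le Finset.univ_nonempty hsum
  exact ⟨fun x => B x j, hcol j, hunit j, by rwa [hdiag] at hj⟩

end TraceAverage

/-- **`Re tr P_K ≥ 1` for `K ≠ ⊥`.** (`tr P_K = dim K ≥ 1`; folklore.) -/
theorem one_le_re_trace_projMatrix_map {n : Type*} [Fintype n] [DecidableEq n]
    (K : Submodule ℂ (n → ℂ)) (hK : K ≠ ⊥) :
    1 ≤ (projMatrix (K.map ((WithLp.linearEquiv 2 ℂ (n → ℂ)).symm :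
      (n → ℂ) →ₗ[ℂ] EuclideanSpace ℂ n))).trace.re := by
  rw [trace_projMatrix_map, Complex.natCast_re, ← Nat.cast_one, Nat.cast_le]
  exact Submodule.one_le_finrank_iff.mpr hK

section Hubbard

open Literature.Probability.LatticeModels

/-- **Non-vacuity of the target's ground eigenspace.** For the Hubbard Hamiltonian on the discrete
torus `(ℤ/L)^d` and `m ≤ |Λ| = L^d`, the joint sector `(N, S^z) = (2m, 0)` contains a ground state
(`szSector_groundState`: `H` is Hermitian and block diagonal in `(N↑, N↓)`), so the sector ground
eigenspace `szSector (2m) 0 ⊓ ker (H - e₀)`, `e₀ = H.minEnergyOn (szSector (2m) 0)`, is not `⊥`.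
Tasaki (2020) §2.2; Lieb, PRL 62 (1989) 1201. [folklore] -/
theorem hubbardTorus_groundEigenspace_ne_bot (d L : ℕ) (t U : ℝ) {m : ℕ}
    (hm : m ≤ Fintype.card (FermionTorus d L)) :
    szSector (Λ := FermionTorus d L) (2 * m) 0 ⊓
        Module.End.eigenspace (Matrix.toLin' (hubbardTorus d L t U))
          (((hubbardTorus d L t U).minEnergyOn
            (szSector (Λ := FermionTorus d L) (2 * m) 0) : ℝ) : ℂ) ≠ ⊥ := by
  obtain ⟨⟨ψ, hψS, hψ0, hHψ⟩, -⟩ := szSector_groundState (fermionTorusGraph d L) t U hm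
  rw [Submodule.ne_bot_iff]
  refine ⟨ψ, Submodule.mem_inf.mpr ⟨hψS, ?_⟩, hψ0⟩
  rw [Module.End.mem_eigenspace_iff, Matrix.toLin'_apply]
  exact hHψ

/-- Membership in the sector ground eigenspace, for a unit vector, is `IsGroundStateInSector`.
[folklore] -/
theorem isGroundStateInSector_of_mem_inf_eigenspace {Λ : Type*} [LinearOrder Λ] [Fintype Λ]
    (H : Matrix (Finset (Orb Λ)) (Finset (Orb Λ)) ℂ) (N : ℕ) (M : ℝ) {ψ : Fock (Orb Λ)}
    (hψ : ψ ∈ szSector N M ⊓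
      Module.End.eigenspace (Matrix.toLin' H) (((H.minEnergyOn (szSector N M)) : ℝ) : ℂ))
    (hunit : star ψ ⬝ᵥ ψ = 1) : IsGroundStateInSector H N M ψ := by
  obtain ⟨hS, hE⟩ := Submodule.mem_inf.mp hψ
  rw [Module.End.mem_eigenspace_iff, Matrix.toLin'_apply] at hE
  refine ⟨hS, ?_, hE⟩
  rintro rfl
  simp at hunit

/-- **In the target, `Re tr P ≥ 1`.** For every side `L ≥ 1`, coupling `U`, hopping `t` and
`δ ≥ -1`, the projection `P` onto the ground eigenspace of `hubbardTorus 2 L t U` in the sector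
`(2⌊(1-δ)L²/2⌋, S^z = 0)`, transported to `EuclideanSpace` by `Fock.toEuclidean`, has
`Re tr P ≥ 1`: the inequality `c·L⁴·Re tr P ≤ Re tr (P Δ_d† Δ_d)` asked by
`BirGroundStateAverageLRO` is never the trivial `0 ≤ 0`. [folklore] -/
theorem one_le_re_trace_groundProj_hubbardTorus (L : ℕ) [NeZero L] (t U δ : ℝ) (hδ : -1 ≤ δ) :
    let N : ℕ := 2 * ⌊(1 - δ) * (L : ℝ) ^ 2 / 2⌋₊
    let H := hubbardTorus 2 L t U
    let S := szSector (Λ := FermionTorus 2 L) N 0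
    let E₀ := S ⊓ Module.End.eigenspace (Matrix.toLin' H) ((H.minEnergyOn S : ℝ) : ℂ)
    let P := projMatrix (E₀.map (Fock.toEuclidean (ι := Orb (FermionTorus 2 L)) :
      Fock (Orb (FermionTorus 2 L)) →ₗ[ℂ] EuclideanSpace ℂ (Finset (Orb (FermionTorus 2 L)))))
    1 ≤ P.trace.re := by
  intro N H S E₀ P
  have hm : ⌊(1 - δ) * (L : ℝ) ^ 2 / 2⌋₊ ≤ Fintype.card (FermionTorus 2 L) := by
    have hcard : Fintype.card (FermionTorus 2 L) = L ^ 2 := by simp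
    rw [hcard]
    apply Nat.floor_le_of_le
    have hL : (0 : ℝ) ≤ (L : ℝ) ^ 2 := by positivity
    push_cast
    nlinarith
  exact one_le_re_trace_projMatrix_map E₀ (hubbardTorus_groundEigenspace_ne_bot 2 L t U hm)

/-- **Every-ground-state form ⇒ the target (average form).** If, for some `δ ∈ (0,1/2)`, an open
window `(U₁,U₂) ⊂ (0,∞)` and `c > 0`, for every `U` in the window, eventually in even `L`, EVERY
normalised ground state `ψ` of `hubbardTorus 2 L 1 U` in the sector `(2⌊(1-δ)L²/2⌋, S^z = 0)` has
`c·L⁴ ≤ Re ⟨ψ, Δ_d† Δ_d ψ⟩`, then `BirGroundStateAverageLRO` holds (state-wise bound ⇒ trace bound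
on the ground eigenspace, `mul_re_trace_projMatrix_map_le`). [folklore] -/
theorem birGroundStateAverageLRO_of_forall_groundState
    (h : ∃ δ ∈ Set.Ioo (0:ℝ) (1/2), ∃ U₁ U₂ c : ℝ, 0 < U₁ ∧ U₁ < U₂ ∧ 0 < c ∧
      ∀ U ∈ Set.Ioo U₁ U₂, ∃ L₀ : ℕ, ∀ (L : ℕ) [NeZero L], L₀ ≤ L → Even L →
        ∀ ψ : Fock (Orb (FermionTorus 2 L)),
          IsGroundStateInSector (hubbardTorus 2 L 1 U) (2 * ⌊(1 - δ) * (L : ℝ) ^ 2 / 2⌋₊) 0 ψ →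
          star ψ ⬝ᵥ ψ = 1 →
          c * (L : ℝ) ^ 4 ≤
            (star ψ ⬝ᵥ ((pairField dWaveFormFactor L)ᴴ * pairField dWaveFormFactor L) *ᵥ ψ).re) :
    BirGroundStateAverageLRO := by
  unfold BirGroundStateAverageLRO
  obtain ⟨δ, hδ, U₁, U₂, c, hU₁, hU₁₂, hc, h⟩ := h
  refine ⟨δ, hδ, U₁, U₂, c, hU₁, hU₁₂, hc, fun U hU => ?_⟩
  obtain ⟨L₀, hL₀⟩ := h U hU
  refine ⟨L₀, fun L _ hL hLe => ?_⟩
  intro N H S E₀ P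
  exact mul_re_trace_projMatrix_map_le E₀ _ (c * (L : ℝ) ^ 4) fun ψ hψ hunit =>
    hL₀ L hL hLe ψ (isGroundStateInSector_of_mem_inf_eigenspace H N 0 hψ hunit) hunit

/-- **The target's trace bound yields a good ground state.** At fixed side `L ≥ 1`, hopping `t`,
coupling `U`, `δ ≥ -1` and `c`, if the average bound `c·L⁴·Re tr P ≤ Re tr (P Δ_d† Δ_d)` of
`BirGroundStateAverageLRO` holds, then SOME normalised ground state `ψ` of `hubbardTorus 2 L t U`
in the sector `(2⌊(1-δ)L²/2⌋, S^z = 0)` has `c·L⁴ ≤ Re ⟨ψ, Δ_d† Δ_d ψ⟩` (pigeonhole over an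
orthonormal basis of the non-trivial ground eigenspace; the first step of average → every).
[folklore] -/
theorem exists_groundState_le_of_trace_bound (L : ℕ) [NeZero L] (t U δ c : ℝ) (hδ : -1 ≤ δ) :
    let N : ℕ := 2 * ⌊(1 - δ) * (L : ℝ) ^ 2 / 2⌋₊
    let H := hubbardTorus 2 L t U
    let S := szSector (Λ := FermionTorus 2 L) N 0
    let E₀ := S ⊓ Module.End.eigenspace (Matrix.toLin' H) ((H.minEnergyOn S : ℝ) : ℂ)
    let P := projMatrix (E₀.map (Fock.toEuclidean (ι := Orb (FermionTorus 2 L)) :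
      Fock (Orb (FermionTorus 2 L)) →ₗ[ℂ] EuclideanSpace ℂ (Finset (Orb (FermionTorus 2 L)))))
    c * (L : ℝ) ^ 4 * P.trace.re ≤
        (P * ((pairField dWaveFormFactor L)ᴴ * pairField dWaveFormFactor L)).trace.re →
      ∃ ψ : Fock (Orb (FermionTorus 2 L)), IsGroundStateInSector H N 0 ψ ∧ star ψ ⬝ᵥ ψ = 1 ∧
        c * (L : ℝ) ^ 4 ≤
          (star ψ ⬝ᵥ ((pairField dWaveFormFactor L)ᴴ * pairField dWaveFormFactor L) *ᵥ ψ).re := by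
  intro N H S E₀ P hP
  have hm : ⌊(1 - δ) * (L : ℝ) ^ 2 / 2⌋₊ ≤ Fintype.card (FermionTorus 2 L) := by
    have hcard : Fintype.card (FermionTorus 2 L) = L ^ 2 := by simp
    rw [hcard]
    apply Nat.floor_le_of_le
    have hL : (0 : ℝ) ≤ (L : ℝ) ^ 2 := by positivity
    push_cast
    nlinarith
  obtain ⟨ψ, hψ, hunit, hle⟩ := exists_unit_le_re_of_trace_projMatrix_map E₀
    (hubbardTorus_groundEigenspace_ne_bot 2 L t U hm) _ (c * (L : ℝ) ^ 4) hP
  exact ⟨ψ, isGroundStateInSector_of_mem_inf_eigenspace H N 0 hψ hunit, hunit, hle⟩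

end Hubbard

end Summit.HubbardSuperconductivity.HubbardSuperconductivity.Theorems
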